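/-
Copyright (c) 2026 the pub-hodgecm-mathlib formalisation cell (harness21).  Prover seat hodgecm-mathlib-K2E1-p16 (g2), Track B «K2-LIT» ENGINE E1, h413 = `stmt-HodgeConjecture-24833`,
route `HCCMUnconditional`, R90-S8 «ContSpec-n½» #2∕#3 chain, deal S8-R156 (2) part 2b (S8 dealer R90-CS-plan (g3)): the ONE letter of (L2) — «continued coordinates holomorphic on the
domains, equal to the tube coordinates on the tube» — READ OFF the ★ meromorphic-exports tuple (rows 6∕8 of this seat), BY NAME.
-/
import Mathlib.Analysis.Calculus.FDeriv.Basic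
import Mathlib.MeasureTheory.Measure.MeasureSpaceDef
import Mathlib.Analysis.Complex.Basic
import HarnessLib

/-!
# h413 ∕ R90-S8 (L2) part 2b — `K2E1ChiScatteringCoordsOnDomainsCMThree`: THE CONTINUED-COORDINATE LETTERS OF ★ p863516 FROM THE ★ MEROMORPHIC EXPORTS (Route X is already ★)

Cell `pub/hodgecm-mathlib`, crux H413 = `stmt-HodgeConjecture-24833`; S8 dealer R90-CS-plan (g3) S8-R156 (2).  THEOREMS ONLY (no `def`, no `instance`, no notation, no named-fact
hypothesis, no `sorry`); lane `--supports stmt-HodgeConjecture-24833 --as helper` (count-neutral).  PURE bookkeeping (no automorphic object named).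

CENSUS (part 2b, the dealer's question «Euler route vs X-system∕BL — which is shorter in OUR tree»).  ROUTE X IS ALREADY ★: ★ row 8 `chiEisenstein_meromorphic_exports_level_cm_three`
(K2E1-p16, general level `K′ ∋ ι(K_∞)`, `U₀`-trivial `ω`; single character = pair currency at `χ₂ = 1`) and ★ row 6 `chiEisenstein_meromorphic_exports_cm_three_of_letters(_of_eigen)` (pair
currency, convolution-data letters) EXPORT the tuple `(q, Ec, qc, P)` with: `q_j` holomorphic on `{2 < Re}` and `Σ_j q_j(z)•b_j = (ν𝓕)⁻¹•φ̃_z` there; `qc_j` MEROMORPHIC IN NORMAL FORM on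
`ℂ`, `qc_j = q_j` on `{2 < Re}`, `P` closed discrete `⊆ {Re ≤ 2}`, `qc_j` analytic off `P` and `DifferentiableOn ℂ (qc_j) Pᶜ` — the glued [BernsteinLapid2019] ball packages.  Hence the
ONE letter of ★ p863516 (`hqcd` on `D`, `hqagree` on the tube, ★ p863497's `hq` without the `(ν𝓕)⁻¹`) is READ OFF that tuple for any domain `D ⊆ Pᶜ` (the road's quarter-plane domains
avoid the discrete `P` — ★ `exists_boxes_of_countable` package) and `ν 𝓕 = 1` (★ final′'s normalisation): this file, three one-liners.  The EULER ROUTE (`qc_j = qc·r_j`, continued Hecke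
quotient × local intertwiners) is NOT needed for (L2); it is the (V)-assembly's SCALAR ROAD for the POLE DATA (L3) at `3∕2` (`hd hdw hreal hβB` of ★ p863403: order and reality of the
pole), which Route X does not locate — that remains the open letter of the `hr2` chain together with (L1) (α′)∕`hOP` and ED. 3's `hdec′`.
* §1 **`tube_coords_of_exports`** — `Σ_j q_j(z)•b_j = Φ z` on `{2 < Re}` from the export clause with the factor `((ν𝓕).toReal⁻¹ : ℂ)` and `ν 𝓕 = 1`.
* §2 **`differentiableOn_coords_of_exports`** — `DifferentiableOn ℂ (qc_j) D` for `D ⊆ Pᶜ`.  §3 **`coords_agree_of_exports`** — `qc_j = q_j` on the tube set, membership form.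
HONEST LABEL: HC_CM is proved only modulo the 7 printed citations (2 remaining named inputs: hLiu418 = `stmt-HodgeConjecture-24832`, h413 = `stmt-HodgeConjecture-24833`) until rung 0
closes; this file asserts no named fact and closes no socket; count-neutral; (L2) of ★ p863403 is now ★ BY NAME modulo rows 6∕8's own visible letters (convolution data `hCD` in the
pair currency; none at `χ₂ = 1` general level beyond the structural binders).

## References
* [BernsteinLapid2019] J. Bernstein, E. Lapid, *On the meromorphic continuation of Eisenstein series*, J. AMS 37 (2024), Thm 2.3, §4, §7.
* [MoeglinWaldspurger1995] C. Mœglin, J.-L. Waldspurger, *Spectral decomposition and Eisenstein series* (1995), IV.1.8–IV.1.11.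
-/

set_option autoImplicit false
-- the mandated namespace repeats `HodgeConjecture.HodgeConjecture`, as in every `Theorems/*.lean` of this sub-problem
set_option linter.dupNamespace false

noncomputable section

open Set
open scoped ENNReal

namespace Summit.HodgeConjecture.HodgeConjecture.Cruxes.H413.K2E1ChiScatteringCoordsOnDomainsCMThree

variable {X : Type*} {ι : Type} [Fintype ι] {b : ι → X → ℂ} {q qc : ι → ℂ → ℂ} {Φ : ℂ → X → ℂ}

/-! ## §1 The tube coordinate identity without the normalising factor -/

/-- **`Σ_j q_j(z)•b_j = Φ z` ON THE TUBE** from the export clause `Σ_j q_j(z)•b_j = ((ν𝓕).toReal⁻¹ : ℂ)•Φ z` and the normalisation `ν 𝓕 = 1` of ★ final′ — the `hq` letter of ★ p863497 ∕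
★ p863516 in membership form on `S := {z | 2 < z.re}`. [cite: BernsteinLapid2019, §4 p. 10] -/
theorem tube_coords_of_exports {m : ℝ≥0∞} (hm : m = 1)
    (hqφ : ∀ z : ℂ, 2 < z.re → (∑ j, q j z • b j) = ((((m.toReal⁻¹ : ℝ)) : ℂ)) • Φ z) :
    ∀ z ∈ {z : ℂ | 2 < z.re}, (∑ j, q j z • b j) = Φ z := fun z hz => by
  rw [hqφ z hz, hm, ENNReal.toReal_one, inv_one, Complex.ofReal_one, one_smul]

/-! ## §2 Holomorphy of the continued coordinates on a domain avoiding the poles -/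

omit [Fintype ι] in
/-- **`qc_j` IS HOLOMORPHIC ON EVERY `D ⊆ Pᶜ`** from the export clause `DifferentiableOn ℂ (qc_j) Pᶜ` — the `hqcd` letter of ★ p863516 at the road's quarter-plane domains.
[cite: BernsteinLapid2019, Thm 2.3] -/
theorem differentiableOn_coords_of_exports {P D : Set ℂ} (hqc : ∀ j, DifferentiableOn ℂ (qc j) Pᶜ) (hDP : D ⊆ Pᶜ) :
    ∀ j, DifferentiableOn ℂ (qc j) D := fun j => (hqc j).mono hDP

/-! ## §3 Agreement on the tube, membership form -/

omit [Fintype ι] in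
/-- **`qc_j = q_j` ON THE TUBE SET** `{z | 2 < z.re}` (membership form of the export clause) — the `hqagree` letter of ★ p863516. [cite: BernsteinLapid2019, §4] -/
theorem coords_agree_of_exports (hqcq : ∀ j (z : ℂ), 2 < z.re → qc j z = q j z) :
    ∀ j, ∀ z ∈ {z : ℂ | 2 < z.re}, qc j z = q j z := fun j z hz => hqcq j z hz

end Summit.HodgeConjecture.HodgeConjecture.Cruxes.H413.K2E1ChiScatteringCoordsOnDomainsCMThree

end
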